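import Literature.MathematicalPhysics.QuantumLattice.PairFieldMomentum
import Literature.MathematicalPhysics.QuantumLattice.TorusPairSusceptibility
import Literature.MathematicalPhysics.QuantumLattice.FermionOperatorsNumberEigenspaceProofs
import Literature.MathematicalPhysics.QuantumLattice.HubbardWave0LiebProofs
import HarnessLib

/-!
# Crux `WcbcsSsbToTorusLRO` (stmt-HubbardSuperconductivity-2009), line `off-zero-mode-moment-closure`:
# stub MC `stub_momentClosure` — the per-side, per-momentum moment method (proved)

For a normalised ground state `ψ` of `H = hubbardTorus 2 L 1 U` in the joint sector `(N, S^z = 0)`,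
`N ≥ 2`, a momentum label `m`, the pair mode `Δ = pairFieldAt dWaveFormFactor L m` and real data
`X, B₁, B₂, B₃, g ≥ 0`, write `E = minEnergyOn H (szSector N 0)`, `E∓ = minEnergyOn H (szSector (N ∓ 2) 0)`,
`v₋ = Δψ`, `v₊ = Δᴴψ`, `S∓ = ‖v∓‖²`, `F̂∓ = Re⟨v∓, H v∓⟩ − E∓ S∓`. IF

* (T₋) `2 Re⟨w, v₋⟩ − (Re⟨w, H w⟩ − E₋‖w‖²) ≤ X` for all `w ∈ szSector (N − 2) 0`, (T₊) the same with
  `v₊`, `E₊` on `szSector (N + 2) 0`;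
* (F1) `Re⟨ψ, (Δᴴ[H,Δ] − [H,Δ]Δᴴ)ψ⟩ ≤ B₁`; (F2) `|Re⟨ψ, (ΔᴴΔ − ΔΔᴴ)ψ⟩| ≤ B₂`; (F3) `|E − E₋| ≤ B₃`;
  (C) `−g ≤ pairGap H N = (E₊ + E₋ − 2E)/2`,

THEN `S₋ ≤ √((B₁ + B₃ B₂) X) + 2 g X`. The proof is finite-dimensional linear algebra:

1. sector bookkeeping `v₋ ∈ szSector (N−2) 0`, `v₊ ∈ szSector (N+2) 0` (CAR: `[N̂, Δ] = −2Δ`,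
   `[S^z, Δ] = 0`, and their adjoints);
2. the resolvent-free Pitaevskii–Stringari kernel (`momentKernel`): testing (T∓) on `w = t • v∓`, `t ∈ ℝ`,
   gives `2ts − t²F̂ ≤ X` for all `t`, whence `F̂ ≥ 0` and `S² ≤ F̂ · X` (discriminant);
3. the own-bottom identity (`dotProduct_doubleComm_of_eigen`, `Hψ = Eψ`, `H` Hermitian):
   `F̂₋ + F̂₊ = Re⟨ψ,(Δᴴ[H,Δ] − [H,Δ]Δᴴ)ψ⟩ + (E − E₋)(S₋ − S₊) − 2·pairGap·S₊ ≤ B₁ + B₃B₂ + 2gS₊`;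
4. the quadratic self-consistency (`momentEndgame_real`): `S₊ ≤ √(B'X) + 2gX`, then `S₋ ≤ √(B'X) + 2gX`.

Feynman (1954) read backwards; L. Pitaevskii, S. Stringari, J. Low Temp. Phys. 85 (1991) 377 (moment
inequalities); H. Tasaki, H. Watanabe (2021) at `q = 0`. Everything here is folklore linear algebra over
the tree's definitions; no definition and no named fact is introduced.
-/

noncomputable section

set_option linter.dupNamespace false

namespace Summit.HubbardSuperconductivity.HubbardSuperconductivity.Theorems.WcbcsSsbToTorusLRO

open Literature.MathematicalPhysics.QuantumLattice Literature.Probability.LatticeModels Matrix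
open scoped ComplexOrder ComplexConjugate

/-! ## §1 Abstract linear algebra: the double-commutator identity and the moment kernel -/

section Abstract

variable {n : Type*} [Fintype n]

/-- `⟨ψ, Mᴴ w⟩ = ⟨Mψ, w⟩`. [folklore] -/
theorem mc_star_dotProduct_conjTranspose_mulVec (M : Matrix n n ℂ) (ψ w : n → ℂ) :
    star ψ ⬝ᵥ (Mᴴ *ᵥ w) = star (M *ᵥ ψ) ⬝ᵥ w := by
  rw [star_mulVec, dotProduct_mulVec]

/-- `⟨ψ, M w⟩ = ⟨Mᴴψ, w⟩`. [folklore] -/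
theorem mc_star_dotProduct_mulVec_eq (M : Matrix n n ℂ) (ψ w : n → ℂ) :
    star ψ ⬝ᵥ (M *ᵥ w) = star (Mᴴ *ᵥ ψ) ⬝ᵥ w := by
  rw [← mc_star_dotProduct_conjTranspose_mulVec, conjTranspose_conjTranspose]

-- adapted from Cruxes/SsbToEvenTorusLro/Lines/pair_yrast_landau_floor.lean (`dotProduct_doubleComm_of_eigen`)
/-- **Double-commutator (own-bottom) identity for an eigenvector**: if `K` is Hermitian and `Kψ = Eψ`
then, for every `A`,
`⟨ψ, (Aᴴ[K,A] − [K,A]Aᴴ) ψ⟩ = (⟨Aψ, K Aψ⟩ − E‖Aψ‖²) + (⟨Aᴴψ, K Aᴴψ⟩ − E‖Aᴴψ‖²)`.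
Pitaevskii–Stringari (1991); Tasaki–Watanabe (2021). [folklore] -/
theorem mc_dotProduct_doubleComm_of_eigen {K : Matrix n n ℂ} (hK : K.IsHermitian) {ψ : n → ℂ}
    {E : ℝ} (hψ : K *ᵥ ψ = (E : ℂ) • ψ) (A : Matrix n n ℂ) :
    star ψ ⬝ᵥ ((Aᴴ * (K * A - A * K) - (K * A - A * K) * Aᴴ) *ᵥ ψ) =
      (star (A *ᵥ ψ) ⬝ᵥ (K *ᵥ (A *ᵥ ψ)) - (E : ℂ) * (star (A *ᵥ ψ) ⬝ᵥ (A *ᵥ ψ))) +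
      (star (Aᴴ *ᵥ ψ) ⬝ᵥ (K *ᵥ (Aᴴ *ᵥ ψ)) - (E : ℂ) * (star (Aᴴ *ᵥ ψ) ⬝ᵥ (Aᴴ *ᵥ ψ))) := by
  have hKw : ∀ w : n → ℂ, star ψ ⬝ᵥ (K *ᵥ w) = (E : ℂ) * (star ψ ⬝ᵥ w) := fun w => by
    rw [mc_star_dotProduct_mulVec_eq, hK.eq, hψ, star_smul, smul_dotProduct, smul_eq_mul,
      Complex.star_def, Complex.conj_ofReal]
  have t1 : star ψ ⬝ᵥ (Aᴴ *ᵥ (K *ᵥ (A *ᵥ ψ))) = star (A *ᵥ ψ) ⬝ᵥ (K *ᵥ (A *ᵥ ψ)) :=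
    mc_star_dotProduct_conjTranspose_mulVec A ψ _
  have t2 : star ψ ⬝ᵥ (Aᴴ *ᵥ (A *ᵥ (K *ᵥ ψ))) = (E : ℂ) * (star (A *ᵥ ψ) ⬝ᵥ (A *ᵥ ψ)) := by
    rw [hψ, mulVec_smul, mulVec_smul, dotProduct_smul, smul_eq_mul,
      mc_star_dotProduct_conjTranspose_mulVec]
  have t3 : star ψ ⬝ᵥ (K *ᵥ (A *ᵥ (Aᴴ *ᵥ ψ))) = (E : ℂ) * (star (Aᴴ *ᵥ ψ) ⬝ᵥ (Aᴴ *ᵥ ψ)) := by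
    rw [hKw, mc_star_dotProduct_mulVec_eq A]
  have t4 : star ψ ⬝ᵥ (A *ᵥ (K *ᵥ (Aᴴ *ᵥ ψ))) = star (Aᴴ *ᵥ ψ) ⬝ᵥ (K *ᵥ (Aᴴ *ᵥ ψ)) :=
    mc_star_dotProduct_mulVec_eq A ψ _
  have hexp : (Aᴴ * (K * A - A * K) - (K * A - A * K) * Aᴴ) *ᵥ ψ =
      (Aᴴ *ᵥ (K *ᵥ (A *ᵥ ψ)) - Aᴴ *ᵥ (A *ᵥ (K *ᵥ ψ))) -
        (K *ᵥ (A *ᵥ (Aᴴ *ᵥ ψ)) - A *ᵥ (K *ᵥ (Aᴴ *ᵥ ψ))) := by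
    simp only [sub_mulVec, ← mulVec_mulVec, mulVec_sub]
  rw [hexp, dotProduct_sub, dotProduct_sub, dotProduct_sub, t1, t2, t3, t4]
  ring

/-- **The scalar moment kernel.** If `s ≥ 0` and `2ts − t²a ≤ X` for every real `t`, then `a ≥ 0` and
`s² ≤ a·X` (for `a < 0` the left side is unbounded in `t`; otherwise the quadratic `a t² − 2 s t + X`
is nonnegative, so its discriminant `4s² − 4aX` is `≤ 0`). Pitaevskii–Stringari (1991). [folklore] -/
theorem momentKernel_real {s a X : ℝ} (hs : 0 ≤ s) (h : ∀ t : ℝ, 2 * t * s - t ^ 2 * a ≤ X) :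
    0 ≤ a ∧ s ^ 2 ≤ a * X := by
  have hX : 0 ≤ X := by have h0 := h 0; simpa using h0
  have ha : 0 ≤ a := by
    by_contra hneg
    push Not at hneg
    have hdpos : 0 < -a := by linarith
    have hane : a ≠ 0 := hneg.ne
    have ht := h ((X + 1) / (-a) + 1)
    have hdt : ((X + 1) / (-a) + 1) * (-a) = X + 1 + (-a) := by
      field_simp
      ring
    have ht0 : 0 ≤ (X + 1) / (-a) := div_nonneg (by linarith) hdpos.le
    have hsq : ((X + 1) / (-a) + 1) ^ 2 * a = -(((X + 1) / (-a) + 1) * (X + 1 + (-a))) := by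
      rw [← hdt]; ring
    rw [hsq] at ht
    nlinarith [mul_nonneg ht0 hs, mul_nonneg ht0 (by linarith : (0 : ℝ) ≤ X + 1 + (-a))]
  refine ⟨ha, ?_⟩
  have hd : discrim a (-2 * s) X ≤ 0 := discrim_le_zero fun t => by
    have ht := h t
    nlinarith [ht]
  rw [discrim] at hd
  nlinarith [hd]

/-- **The resolvent-free Pitaevskii–Stringari kernel in a sector.** For a matrix `A`, a subspace `K`,
reals `E`, `X` and `v ∈ K`: if `2 Re⟨w, v⟩ − (Re⟨w, A w⟩ − E‖w‖²) ≤ X` for all `w ∈ K`, then, with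
`F̂ = Re⟨v, A v⟩ − E‖v‖²`, `F̂ ≥ 0` and `‖v‖⁴ ≤ F̂ · X` (test `w = t • v`, `t ∈ ℝ`). Optimising over
`w` this is `‖v‖⁴ ≤ ⟨v,(A−E)v⟩ ⟨v,(A−E)⁻¹v⟩`. Pitaevskii–Stringari (1991). [folklore] -/
theorem momentKernel (A : Matrix n n ℂ) (K : Submodule ℂ (n → ℂ)) (E X : ℝ) {v : n → ℂ}
    (hv : v ∈ K)
    (hX : ∀ w ∈ K, 2 * (star w ⬝ᵥ v).re - ((star w ⬝ᵥ (A *ᵥ w)).re - E * (star w ⬝ᵥ w).re) ≤ X) :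
    0 ≤ (star v ⬝ᵥ (A *ᵥ v)).re - E * (star v ⬝ᵥ v).re ∧
      (star v ⬝ᵥ v).re ^ 2 ≤ ((star v ⬝ᵥ (A *ᵥ v)).re - E * (star v ⬝ᵥ v).re) * X := by
  have hs : 0 ≤ (star v ⬝ᵥ v).re := (Complex.nonneg_iff.1 (dotProduct_star_self_nonneg v)).1
  refine momentKernel_real hs fun t => ?_
  have hw : ((t : ℂ) • v) ∈ K := K.smul_mem _ hv
  have h := hX _ hw
  have e1 : star ((t : ℂ) • v) ⬝ᵥ v = (t : ℂ) * (star v ⬝ᵥ v) := by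
    rw [star_smul, smul_dotProduct, smul_eq_mul, Complex.star_def, Complex.conj_ofReal]
  have e2 : star ((t : ℂ) • v) ⬝ᵥ (A *ᵥ ((t : ℂ) • v)) =
      (t : ℂ) * ((t : ℂ) * (star v ⬝ᵥ (A *ᵥ v))) := by
    rw [mulVec_smul, dotProduct_smul, star_smul, smul_dotProduct, smul_eq_mul, smul_eq_mul,
      Complex.star_def, Complex.conj_ofReal]
  have e3 : star ((t : ℂ) • v) ⬝ᵥ ((t : ℂ) • v) = (t : ℂ) * ((t : ℂ) * (star v ⬝ᵥ v)) := by
    rw [dotProduct_smul, star_smul, smul_dotProduct, smul_eq_mul, smul_eq_mul, Complex.star_def,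
      Complex.conj_ofReal]
  rw [e1, e2, e3] at h
  simp only [Complex.re_ofReal_mul] at h
  linarith [h]

/-- **The real endgame (quadratic self-consistency).** From `S₋ ≥ 0`, `F̂∓ ≥ 0`, the two kernels
`S∓² ≤ F̂∓ X` and the own-bottom budget `F̂₋ + F̂₊ ≤ B + 2 g S₊` (`X, B, g ≥ 0`):
first `S₊ ≤ √(BX) + 2gX` (from `S₊² ≤ BX + 2gX·S₊`), then `F̂₋ ≤ B + 2g√(BX) + 4g²X`, so
`S₋² ≤ (√(BX) + 2gX)²`. [folklore] -/
theorem momentEndgame_real {Sm Sp Fm Fp X B g : ℝ} (hSm : 0 ≤ Sm) (hFm : 0 ≤ Fm)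
    (hFp : 0 ≤ Fp) (hX : 0 ≤ X) (hB : 0 ≤ B) (hg : 0 ≤ g)
    (hKm : Sm ^ 2 ≤ Fm * X) (hKp : Sp ^ 2 ≤ Fp * X) (hsum : Fm + Fp ≤ B + 2 * g * Sp) :
    Sm ≤ Real.sqrt (B * X) + 2 * g * X := by
  set r := Real.sqrt (B * X) with hr
  have hr0 : 0 ≤ r := Real.sqrt_nonneg _
  have hr2 : r ^ 2 = B * X := Real.sq_sqrt (mul_nonneg hB hX)
  have hgX : 0 ≤ g * X := mul_nonneg hg hX
  -- step 1 : `S₊ ≤ r + 2 g X`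
  have hFp' : Fp ≤ B + 2 * g * Sp := by linarith
  have h1 : Sp ^ 2 ≤ r ^ 2 + 2 * (g * X) * Sp := by
    have := mul_le_mul_of_nonneg_right hFp' hX
    nlinarith [this]
  have hSp' : Sp ≤ r + 2 * g * X := by
    by_contra hlt
    push Not at hlt
    have hSpos : 0 < Sp := lt_of_le_of_lt (by positivity) hlt
    have h2 := mul_lt_mul_of_pos_left hlt hSpos
    have h3 : r * r ≤ r * Sp := mul_le_mul_of_nonneg_left (by linarith) hr0
    nlinarith [h1, h2, h3]
  -- step 2 : `F̂₋ ≤ B + 2 g (r + 2 g X)`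
  have hFm' : Fm ≤ B + 2 * g * (r + 2 * g * X) := by
    have := mul_le_mul_of_nonneg_left hSp' (by positivity : (0 : ℝ) ≤ 2 * g)
    linarith
  -- step 3 : `S₋² ≤ (r + 2 g X)²`
  have h3 : Sm ^ 2 ≤ (r + 2 * g * X) ^ 2 := by
    have := mul_le_mul_of_nonneg_right hFm' hX
    nlinarith [this, hr2, mul_nonneg (mul_nonneg hg hr0) hX]
  exact (sq_le_sq₀ hSm (by positivity)).1 h3

end Abstract

/-! ## §2 Sector bookkeeping: `Δ_g(m)` lowers, `Δ_g(m)ᴴ` raises the particle number by two at fixed `S^z` -/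

section Sector

/-- `N`-particle vectors are the `N`-eigenvectors of the total number operator `N̂`
(`nParticleSubmodule_eq_eigenspace_holds`, restated with `totalNumber`). Tasaki (2020) §9.2. [folklore] -/
theorem mc_isNParticle_iff_totalNumber_mulVec {Λ : Type*} [LinearOrder Λ] [Fintype Λ] (M : ℕ)
    (φ : Fock (Orb Λ)) :
    IsNParticle M φ ↔ (totalNumber : Matrix (Finset (Orb Λ)) (Finset (Orb Λ)) ℂ) *ᵥ φ = (M : ℂ) • φ := by
  rw [← mem_nParticleSubmodule_iff, nParticleSubmodule_eq_eigenspace_holds (ι := Orb Λ) M,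
    Module.End.mem_eigenspace_iff, Matrix.toLin'_apply, totalNumberOp_eq_totalNumber]

variable {L : ℕ} [NeZero L]

/-- **`Δ_g(m)` maps the joint sector `(N, S^z = M)`, `N ≥ 2`, into `(N − 2, S^z = M)`**
(`[N̂, Δ_g(m)] = −2 Δ_g(m)`, `[S^z, Δ_g(m)] = 0`). Essler et al. (2005) §2.2.5; Tasaki (2020) §9.3. [folklore] -/
theorem pairFieldAt_mulVec_mem_szSector (g : Site 2 → ℝ) (m : TorusSite 2 L) {N : ℕ} (hN : 2 ≤ N)
    {M : ℝ} {φ : Fock (Orb (FermionTorus 2 L))} (hφ : φ ∈ szSector N M) :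
    pairFieldAt g L m *ᵥ φ ∈ szSector (N - 2) M := by
  rw [mem_szSector_iff] at hφ ⊢
  obtain ⟨hNφ, hSφ⟩ := hφ
  refine ⟨?_, ?_⟩
  · rw [mc_isNParticle_iff_totalNumber_mulVec] at hNφ ⊢
    have hc' : totalNumber * pairFieldAt g L m =
        pairFieldAt g L m * totalNumber + (-2 : ℂ) • pairFieldAt g L m :=
      sub_eq_iff_eq_add'.1 (totalNumber_commutator_pairFieldAt g L m)
    rw [mulVec_mulVec, hc', add_mulVec, ← mulVec_mulVec, hNφ, mulVec_smul, smul_mulVec, ← add_smul,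
      Nat.cast_sub hN, Nat.cast_ofNat, sub_eq_add_neg]
  · rw [mulVec_mulVec, (spinZ_commute_pairFieldAt g L m).eq, ← mulVec_mulVec, hSφ, mulVec_smul]

/-- **`Δ_g(m)ᴴ` maps the joint sector `(N, S^z = M)` into `(N + 2, S^z = M)`** (adjoints of
`[N̂, Δ_g(m)] = −2 Δ_g(m)`, `[S^z, Δ_g(m)] = 0`; `N̂`, `S^z` Hermitian). Essler et al. (2005) §2.2.5;
Tasaki (2020) §9.3. [folklore] -/
theorem conjTranspose_pairFieldAt_mulVec_mem_szSector (g : Site 2 → ℝ) (m : TorusSite 2 L) {N : ℕ}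
    {M : ℝ} {φ : Fock (Orb (FermionTorus 2 L))} (hφ : φ ∈ szSector N M) :
    (pairFieldAt g L m)ᴴ *ᵥ φ ∈ szSector (N + 2) M := by
  rw [mem_szSector_iff] at hφ ⊢
  obtain ⟨hNφ, hSφ⟩ := hφ
  refine ⟨?_, ?_⟩
  · rw [mc_isNParticle_iff_totalNumber_mulVec] at hNφ ⊢
    have hc := congrArg conjTranspose (totalNumber_commutator_pairFieldAt g L m)
    simp only [conjTranspose_sub, conjTranspose_mul, conjTranspose_smul, totalNumber_isHermitian.eq,
      star_neg, star_ofNat] at hc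
    have hc' : totalNumber * (pairFieldAt g L m)ᴴ =
        (pairFieldAt g L m)ᴴ * totalNumber + (2 : ℂ) • (pairFieldAt g L m)ᴴ := by
      calc totalNumber * (pairFieldAt g L m)ᴴ
          = (pairFieldAt g L m)ᴴ * totalNumber -
              ((pairFieldAt g L m)ᴴ * totalNumber - totalNumber * (pairFieldAt g L m)ᴴ) := by abel
        _ = (pairFieldAt g L m)ᴴ * totalNumber - (-2 : ℂ) • (pairFieldAt g L m)ᴴ := by rw [hc]
        _ = (pairFieldAt g L m)ᴴ * totalNumber + (2 : ℂ) • (pairFieldAt g L m)ᴴ := by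
          rw [neg_smul, sub_neg_eq_add]
    rw [mulVec_mulVec, hc', add_mulVec, ← mulVec_mulVec, hNφ, mulVec_smul, smul_mulVec, ← add_smul,
      Nat.cast_add, Nat.cast_ofNat]
  · have hS : Commute HubbardWave0.spinZ (pairFieldAt g L m)ᴴ := by
      have h := congrArg conjTranspose (spinZ_commute_pairFieldAt g L m).eq
      simp only [conjTranspose_mul, HubbardWave0.spinZ_isHermitian.eq] at h
      exact h.symm
    rw [mulVec_mulVec, hS.eq, ← mulVec_mulVec, hSφ, mulVec_smul]

end Sector

/-! ## §3 The stub -/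

/-- **Stub MC — `stub_momentClosure` (the per-side moment method; finite-dimensional).** For a normalised
ground state `ψ` of `H = hubbardTorus 2 L 1 U` in the sector `(N, S^z=0)`, `N ≥ 2`, a momentum label `m`, the pair mode
`Δ = pairFieldAt d L m` and real data `X, B₁, B₂, B₃, g ≥ 0`: IF (T₋) `2Re⟨w,Δψ⟩ − Re⟨w,(H−E₋)w⟩ ≤ X` on the sector
`(N−2, 0)` and (T₊) the same with `Δᴴψ`, `E₊` on `(N+2, 0)`; (F1) `Re⟨ψ,(Δᴴ[H,Δ] − [H,Δ]Δᴴ)ψ⟩ ≤ B₁`;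
(F2) `|Re⟨ψ,(ΔᴴΔ − ΔΔᴴ)ψ⟩| ≤ B₂`; (F3) `|E − E₋| ≤ B₃`; (C) `−g ≤ pairGap H N` — THEN
`‖Δψ‖² ≤ √((B₁ + B₃B₂) X) + 2 g X`. Proof: `Δψ ∈ (N−2,0)`, `Δᴴψ ∈ (N+2,0)` (`pairFieldAt_mulVec_mem_szSector`,
`conjTranspose_pairFieldAt_mulVec_mem_szSector`); the kernel `momentKernel` in both sectors (`F̂∓ ≥ 0`,
`S∓² ≤ F̂∓ X`); the own-bottom identity `mc_dotProduct_doubleComm_of_eigen` (`Hψ = Eψ`, `H` Hermitian) giving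
`F̂₋ + F̂₊ = Re⟨ψ,(Δᴴ[H,Δ]−[H,Δ]Δᴴ)ψ⟩ + (E−E₋)(S₋−S₊) − 2·pairGap·S₊ ≤ B₁ + B₃B₂ + 2gS₊`; and `momentEndgame_real`.
Pitaevskii–Stringari (1991); Tasaki–Watanabe (2021). [folklore] -/
theorem stub_momentClosure :
    ∀ (L : ℕ) [NeZero L] (U : ℝ) (N : ℕ), 2 ≤ N → ∀ (ψ : Fock (Orb (FermionTorus 2 L))), IsGroundStateInSector (hubbardTorus 2 L 1 U) N 0 ψ → star ψ ⬝ᵥ ψ = 1 → ∀ (m : TorusSite 2 L) (X B₁ B₂ B₃ g : ℝ), 0 ≤ X → 0 ≤ B₁ → 0 ≤ B₂ → 0 ≤ B₃ → 0 ≤ g → (∀ w : Fock (Orb (FermionTorus 2 L)), w ∈ szSector (Λ := FermionTorus 2 L) (N - 2) 0 → 2 * (star w ⬝ᵥ (pairFieldAt dWaveFormFactor L m *ᵥ ψ)).re - ((star w ⬝ᵥ (hubbardTorus 2 L 1 U *ᵥ w)).re - (hubbardTorus 2 L 1 U).minEnergyOn (szSector (N - 2) 0) * (star w ⬝ᵥ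 w).re) ≤ X) → (∀ w : Fock (Orb (FermionTorus 2 L)), w ∈ szSector (Λ := FermionTorus 2 L) (N + 2) 0 → 2 * (star w ⬝ᵥ ((pairFieldAt dWaveFormFactor L m)ᴴ *ᵥ ψ)).re - ((star w ⬝ᵥ (hubbardTorus 2 L 1 U *ᵥ w)).re - (hubbardTorus 2 L 1 U).minEnergyOn (szSector (N + 2) 0) * (star w ⬝ᵥ w).re) ≤ X) → (star ψ ⬝ᵥ (((pairFieldAt dWaveFormFactor L m)ᴴ * (hubbardTorus 2 L 1 U * pairFieldAt dWaveFormFactor L m - pairFieldAt dWaveFormFactor L m * hubbardTorus 2 L 1 U) - (hubbardTorus 2 L 1 U * pairFieldAt dWaveFormFactor L m - pairFieldAt dWaveFormFactor L m * hubbardTorus 2 L 1 U) * (pairFieldAt dWaveFormFactor L m)ᴴ) *ᵥ ψ)).re ≤ B₁ → |(star ψ ⬝ᵥ (((pairFieldAt dWaveFormFactor L m)ᴴ * pairFieldAt dWaveFormFactor L m - pairFieldAt dWaveFormFactor L m * (pairFieldAt dWaveFormFactor L m)ᴴ) *ᵥ ψ)).re| ≤ B₂ → |(hubbardTorus 2 L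 1 U).minEnergyOn (szSector N 0) - (hubbardTorus 2 L 1 U).minEnergyOn (szSector (N - 2) 0)| ≤ B₃ → -g ≤ pairGap (hubbardTorus 2 L 1 U) N → (star (pairFieldAt dWaveFormFactor L m *ᵥ ψ) ⬝ᵥ (pairFieldAt dWaveFormFactor L m *ᵥ ψ)).re ≤ Real.sqrt ((B₁ + B₃ * B₂) * X) + 2 * g * X := by
  intro L _ U N hN ψ hψ _hψ1 m X B₁ B₂ B₃ g hX hB₁ _hB₂ hB₃ hg hTm hTp hF1 hF2 hF3 hC
  unfold pairGap at hC
  set H := hubbardTorus 2 L 1 U with hHdef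
  set Δ := pairFieldAt dWaveFormFactor L m with hΔdef
  set E := H.minEnergyOn (szSector N 0) with hEdef
  set Em := H.minEnergyOn (szSector (N - 2) 0) with hEmdef
  set Ep := H.minEnergyOn (szSector (N + 2) 0) with hEpdef
  obtain ⟨hψK, -, hHψ⟩ := hψ
  have hHerm : H.IsHermitian := LiebThm1.hamiltonian_isHermitian (fermionTorusGraph 2 L) 1 U
  -- (1) sector bookkeeping
  have hvm : Δ *ᵥ ψ ∈ szSector (N - 2) 0 := pairFieldAt_mulVec_mem_szSector dWaveFormFactor m hN hψK
  have hvp : Δᴴ *ᵥ ψ ∈ szSector (N + 2) 0 :=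
    conjTranspose_pairFieldAt_mulVec_mem_szSector dWaveFormFactor m hψK
  -- (2) the two kernels (they also give `F̂∓ ≥ 0`)
  obtain ⟨hFm0, hKm⟩ := momentKernel H (szSector (N - 2) 0) Em X hvm hTm
  obtain ⟨hFp0, hKp⟩ := momentKernel H (szSector (N + 2) 0) Ep X hvp hTp
  -- (3) the own-bottom identity
  rw [mc_dotProduct_doubleComm_of_eigen hHerm hHψ Δ] at hF1
  simp only [Complex.add_re, Complex.sub_re, Complex.re_ofReal_mul] at hF1
  have hSm : star (Δ *ᵥ ψ) ⬝ᵥ (Δ *ᵥ ψ) = star ψ ⬝ᵥ ((Δᴴ * Δ) *ᵥ ψ) :=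
    star_mulVec_dotProduct_mulVec Δ Δ ψ
  have hSp : star (Δᴴ *ᵥ ψ) ⬝ᵥ (Δᴴ *ᵥ ψ) = star ψ ⬝ᵥ ((Δ * Δᴴ) *ᵥ ψ) := by
    rw [star_mulVec_dotProduct_mulVec, conjTranspose_conjTranspose]
  have hdiff : (star ψ ⬝ᵥ ((Δᴴ * Δ - Δ * Δᴴ) *ᵥ ψ)).re =
      (star (Δ *ᵥ ψ) ⬝ᵥ (Δ *ᵥ ψ)).re - (star (Δᴴ *ᵥ ψ) ⬝ᵥ (Δᴴ *ᵥ ψ)).re := by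
    rw [sub_mulVec, dotProduct_sub, Complex.sub_re, hSm, hSp]
  rw [hdiff] at hF2
  have hSm0 : 0 ≤ (star (Δ *ᵥ ψ) ⬝ᵥ (Δ *ᵥ ψ)).re :=
    (Complex.nonneg_iff.1 (dotProduct_star_self_nonneg _)).1
  have hSp0 : 0 ≤ (star (Δᴴ *ᵥ ψ) ⬝ᵥ (Δᴴ *ᵥ ψ)).re :=
    (Complex.nonneg_iff.1 (dotProduct_star_self_nonneg _)).1
  set Sm := (star (Δ *ᵥ ψ) ⬝ᵥ (Δ *ᵥ ψ)).re with hSmdef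
  set Sp := (star (Δᴴ *ᵥ ψ) ⬝ᵥ (Δᴴ *ᵥ ψ)).re with hSpdef
  set am := (star (Δ *ᵥ ψ) ⬝ᵥ (H *ᵥ (Δ *ᵥ ψ))).re with hamdef
  set ap := (star (Δᴴ *ᵥ ψ) ⬝ᵥ (H *ᵥ (Δᴴ *ᵥ ψ))).re with hapdef
  -- the own-bottom budget `F̂₋ + F̂₊ ≤ B₁ + B₃ B₂ + 2 g S₊`
  have h1 : (E - Em) * (Sm - Sp) ≤ B₃ * B₂ :=
    calc (E - Em) * (Sm - Sp) ≤ |(E - Em) * (Sm - Sp)| := le_abs_self _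
      _ = |E - Em| * |Sm - Sp| := abs_mul _ _
      _ ≤ B₃ * B₂ := mul_le_mul hF3 hF2 (abs_nonneg _) hB₃
  have h2 : (2 * E - Em - Ep) * Sp ≤ 2 * g * Sp := mul_le_mul_of_nonneg_right (by linarith) hSp0
  have hsum : (am - Em * Sm) + (ap - Ep * Sp) ≤ (B₁ + B₃ * B₂) + 2 * g * Sp := by nlinarith [hF1, h1, h2]
  -- (4) the real endgame
  exact momentEndgame_real hSm0 hFm0 hFp0 hX (by positivity) hg hKm hKp hsum

end Summit.HubbardSuperconductivity.HubbardSuperconductivity.Theorems.WcbcsSsbToTorusLRO
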